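import Mathlib.Analysis.Calculus.SmoothSeries
import Mathlib.Analysis.Calculus.FDeriv.Mul
import Mathlib.Analysis.Calculus.FDeriv.Pow
import Mathlib.Analysis.Calculus.FDeriv.Prod
import Mathlib.Analysis.Calculus.ContDiff.Basic
import Mathlib.Analysis.SpecificLimits.Basic
import Mathlib.Analysis.Convex.Topology
import Mathlib.Data.Finsupp.Weight

/-!
# `StokesGeneration` (stmt-KontsevichZagierPeriods-3586), line `Sketch`, stub `stub_spanToReps` — part 1:
real power series on an open box are `C¹`, with termwise partial derivatives

Support file (pure Mathlib) for the registered stub `stub_spanToReps` (dictionary, folding half)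
of the crux `StokesGeneration` (route UnfoldedStokes, line `Sketch` = card cube-type-a-generation).

For real coefficients `γ : (Fin M →₀ ℕ) → ℝ` with `Σₐ |γ a| r^{|a|} < ∞` and `1 ≤ ρ < r`, the sum
`g(x) = Σₐ γ(a) ∏ₗ xₗ^{aₗ}` is of class `C¹` on the open box `(-ρ, ρ)ᴹ`
(`contDiffOn_tsum_monomial`), with Fréchet derivative the sum of the derivatives of its terms
(`hasFDerivAt_tsum_monomial`, Mathlib's `hasFDerivAt_tsum_of_isPreconnected`: the operator norm of
the derivative of the monomial `xᵃ` on the box is at most `|a| ρ^{|a|}`, and `|a| ρ^{|a|} ≤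
(1 - ρ/r)⁻¹ r^{|a|}`); in particular its partial derivatives are the termwise ones,
`∂g/∂xₗ (x) = Σₐ γ(a) aₗ xₗ^{aₗ - 1} ∏_{l' ≠ l} x_{l'}^{a_{l'}}` (`fderiv_tsum_monomial_apply_single`).

This is the regularity input of the folding half of the dictionary between Ayoub's series
`𝒪_{ℚ̄-alg}(𝔻̄^∞)` and real `C¹` functions near the closed unit cube (J. Ayoub, EMS Newsl. 91 (2014)
§2.2, Def. 10 and Rem. 13). No definition is introduced.
-/

noncomputable section

-- `Summit.KontsevichZagierPeriods.KontsevichZagierPeriods.…` is the tree's mandated layout (single-conjunct summit).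
set_option linter.dupNamespace false

namespace Summit.KontsevichZagierPeriods.KontsevichZagierPeriods.StokesGenerationLine

open Set Filter
open scoped Topology

variable {M : ℕ}

/-! ## Elementary bounds -/

/-- `n tⁿ ≤ (1 - t)⁻¹` for `0 ≤ t < 1` (`n tⁿ ≤ Σ_{k<n} tᵏ ≤ Σ_k tᵏ`). [folklore] -/
theorem nat_mul_pow_le_inv_one_sub {t : ℝ} (ht0 : 0 ≤ t) (ht1 : t < 1) (n : ℕ) :
    (n : ℝ) * t ^ n ≤ (1 - t)⁻¹ := by
  have h1 : (n : ℝ) * t ^ n ≤ ∑ k ∈ Finset.range n, t ^ k := by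
    have hk : ∀ k ∈ Finset.range n, t ^ n ≤ t ^ k := fun k hk =>
      pow_le_pow_of_le_one ht0 ht1.le (Finset.mem_range.mp hk).le
    calc (n : ℝ) * t ^ n = ∑ _k ∈ Finset.range n, t ^ n := by simp
      _ ≤ ∑ k ∈ Finset.range n, t ^ k := Finset.sum_le_sum hk
  exact h1.trans (sum_le_hasSum _ (fun k _ => pow_nonneg ht0 k) (hasSum_geometric_of_lt_one ht0 ht1))

/-- `n ρⁿ ≤ (1 - ρ/r)⁻¹ rⁿ` for `0 ≤ ρ < r`. [folklore] -/
theorem nat_mul_pow_le_const_mul_pow {ρ r : ℝ} (hρ : 0 ≤ ρ) (hρr : ρ < r) (n : ℕ) :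
    (n : ℝ) * ρ ^ n ≤ (1 - ρ / r)⁻¹ * r ^ n := by
  have hr : 0 < r := hρ.trans_lt hρr
  have ht1 : ρ / r < 1 := (div_lt_one hr).mpr hρr
  have h := nat_mul_pow_le_inv_one_sub (div_nonneg hρ hr.le) ht1 n
  have hρn : ρ ^ n = (ρ / r) ^ n * r ^ n := by
    rw [div_pow, div_mul_cancel₀ _ (pow_ne_zero n hr.ne')]
  rw [hρn, ← mul_assoc]
  exact mul_le_mul_of_nonneg_right h (pow_nonneg hr.le n)

/-- `|∏ₗ yₗ^{aₗ}| ≤ ρ^{|a|}` when `|yₗ| ≤ ρ`. [folklore] -/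
theorem abs_monomial_le (a : Fin M →₀ ℕ) {ρ : ℝ} {y : Fin M → ℝ} (hy : ∀ l, |y l| ≤ ρ) :
    |∏ l, y l ^ a l| ≤ ρ ^ a.degree := by
  rw [Finset.abs_prod]
  calc ∏ l, |y l ^ a l| = ∏ l, |y l| ^ a l := Finset.prod_congr rfl fun l _ => abs_pow _ _
    _ ≤ ∏ l, ρ ^ a l := Finset.prod_le_prod (fun l _ => pow_nonneg (abs_nonneg _) _)
        fun l _ => pow_le_pow_left₀ (abs_nonneg _) (hy l) _
    _ = ρ ^ a.degree := by rw [Finset.prod_pow_eq_pow_sum, Finsupp.degree_eq_sum]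

/-- The monomial series `Σₐ γ(a) yᵃ` converges absolutely at every point of the closed box of
radius `ρ ≤ r` when `Σₐ |γ a| r^{|a|} < ∞`. [folklore] -/
theorem summable_monomialSeries (γ : (Fin M →₀ ℕ) → ℝ) {ρ r : ℝ} (hρ : 0 ≤ ρ) (hρr : ρ ≤ r)
    (hs : Summable fun a => |γ a| * r ^ a.degree) {y : Fin M → ℝ} (hy : ∀ l, |y l| ≤ ρ) :
    Summable fun a : Fin M →₀ ℕ => γ a * ∏ l, y l ^ a l := by
  refine Summable.of_norm_bounded hs fun a => ?_
  rw [Real.norm_eq_abs, abs_mul]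
  refine mul_le_mul_of_nonneg_left ((abs_monomial_le a hy).trans ?_) (abs_nonneg _)
  exact pow_le_pow_left₀ hρ hρr _

/-! ## The derivative of a monomial -/

/-- The Fréchet derivative of the monomial `x ↦ ∏ₗ xₗ^{aₗ}` (product rule). [folklore] -/
theorem hasFDerivAt_monomial (a : Fin M →₀ ℕ) (x : Fin M → ℝ) :
    HasFDerivAt (fun y : Fin M → ℝ => ∏ l, y l ^ a l)
      (∑ l, (∏ l' ∈ Finset.univ.erase l, x l' ^ a l') •
        ((a l • x l ^ (a l - 1)) •
          ContinuousLinearMap.proj (R := ℝ) (φ := fun _ : Fin M => ℝ) l)) x :=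
  HasFDerivAt.finsetProd (u := Finset.univ) (g := fun l (y : Fin M → ℝ) => y l ^ a l)
    fun l _ => (hasFDerivAt_apply l x).pow (a l)

/-- The derivative of the monomial, evaluated at a vector. [folklore] -/
theorem monomialDeriv_apply (a : Fin M →₀ ℕ) (x v : Fin M → ℝ) :
    (∑ l, (∏ l' ∈ Finset.univ.erase l, x l' ^ a l') •
        ((a l • x l ^ (a l - 1)) •
          ContinuousLinearMap.proj (R := ℝ) (φ := fun _ : Fin M => ℝ) l)) v =
      ∑ l, (∏ l' ∈ Finset.univ.erase l, x l' ^ a l') * ((a l : ℝ) * x l ^ (a l - 1) * v l) := by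
  simp only [_root_.sum_apply, _root_.smul_apply, ContinuousLinearMap.proj_apply, smul_eq_mul,
    nsmul_eq_mul]

/-- The derivative of the monomial along the coordinate vector `eₗ`:
`aₗ xₗ^{aₗ-1} ∏_{l' ≠ l} x_{l'}^{a_{l'}}`. [folklore] -/
theorem monomialDeriv_apply_single (a : Fin M →₀ ℕ) (x : Fin M → ℝ) (l : Fin M) :
    (∑ l, (∏ l' ∈ Finset.univ.erase l, x l' ^ a l') •
        ((a l • x l ^ (a l - 1)) •
          ContinuousLinearMap.proj (R := ℝ) (φ := fun _ : Fin M => ℝ) l)) (Pi.single l 1) =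
      (∏ l' ∈ Finset.univ.erase l, x l' ^ a l') * ((a l : ℝ) * x l ^ (a l - 1)) := by
  rw [monomialDeriv_apply, Finset.sum_eq_single l]
  · rw [Pi.single_eq_same, mul_one]
  · intro l'' _ hne
    rw [Pi.single_eq_of_ne hne, mul_zero, mul_zero]
  · intro h
    exact absurd (Finset.mem_univ l) h

/-- **Operator norm of the derivative of a monomial on the box of radius `ρ ≥ 1`**:
`‖D(xᵃ)‖ ≤ |a| ρ^{|a|}`. [folklore] -/
theorem norm_monomialDeriv_le (a : Fin M →₀ ℕ) {ρ : ℝ} (hρ : 1 ≤ ρ) {x : Fin M → ℝ}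
    (hx : ∀ l, |x l| ≤ ρ) :
    ‖∑ l, (∏ l' ∈ Finset.univ.erase l, x l' ^ a l') •
        ((a l • x l ^ (a l - 1)) •
          ContinuousLinearMap.proj (R := ℝ) (φ := fun _ : Fin M => ℝ) l)‖ ≤
      (a.degree : ℝ) * ρ ^ a.degree := by
  have hρ0 : 0 ≤ ρ := zero_le_one.trans hρ
  refine ContinuousLinearMap.opNorm_le_bound _ (by positivity) fun v => ?_
  rw [monomialDeriv_apply]
  have hterm : ∀ l, ‖(∏ l' ∈ Finset.univ.erase l, x l' ^ a l') *
      ((a l : ℝ) * x l ^ (a l - 1) * v l)‖ ≤ (a l : ℝ) * ρ ^ a.degree * ‖v‖ := by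
    intro l
    have hdeg : a l ≤ a.degree := by
      rw [Finsupp.degree_eq_sum]
      exact Finset.single_le_sum (fun l' _ => Nat.zero_le (a l')) (Finset.mem_univ l)
    have hc : |∏ l' ∈ Finset.univ.erase l, x l' ^ a l'| ≤ ρ ^ (a.degree - a l) := by
      rw [Finset.abs_prod]
      calc ∏ l' ∈ Finset.univ.erase l, |x l' ^ a l'|
          = ∏ l' ∈ Finset.univ.erase l, |x l'| ^ a l' :=
            Finset.prod_congr rfl fun l' _ => abs_pow _ _
        _ ≤ ∏ l' ∈ Finset.univ.erase l, ρ ^ a l' :=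
            Finset.prod_le_prod (fun l' _ => pow_nonneg (abs_nonneg _) _)
              fun l' _ => pow_le_pow_left₀ (abs_nonneg _) (hx l') _
        _ = ρ ^ (a.degree - a l) := by
            rw [Finset.prod_pow_eq_pow_sum]
            congr 1
            have h := Finset.sum_erase_add Finset.univ (fun l' => a l') (Finset.mem_univ l)
            rw [← Finsupp.degree_eq_sum] at h
            omega
    have hd : |x l| ^ (a l - 1) ≤ ρ ^ (a l - 1) := pow_le_pow_left₀ (abs_nonneg _) (hx l) _
    have hv : |v l| ≤ ‖v‖ := by
      have := norm_le_pi_norm v l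
      rwa [Real.norm_eq_abs] at this
    have hexp : ρ ^ (a.degree - a l) * ρ ^ (a l - 1) ≤ ρ ^ a.degree := by
      rw [← pow_add]
      exact pow_le_pow_right₀ hρ (by omega)
    calc ‖(∏ l' ∈ Finset.univ.erase l, x l' ^ a l') * ((a l : ℝ) * x l ^ (a l - 1) * v l)‖
        = |∏ l' ∈ Finset.univ.erase l, x l' ^ a l'| * ((a l : ℝ) * |x l| ^ (a l - 1) * |v l|) := by
          rw [Real.norm_eq_abs, abs_mul, abs_mul, abs_mul, abs_pow, Nat.abs_cast]
      _ ≤ ρ ^ (a.degree - a l) * ((a l : ℝ) * ρ ^ (a l - 1) * ‖v‖) := by gcongr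
      _ = (a l : ℝ) * (ρ ^ (a.degree - a l) * ρ ^ (a l - 1)) * ‖v‖ := by ring
      _ ≤ (a l : ℝ) * ρ ^ a.degree * ‖v‖ := by gcongr
  calc ‖∑ l, (∏ l' ∈ Finset.univ.erase l, x l' ^ a l') * ((a l : ℝ) * x l ^ (a l - 1) * v l)‖
      ≤ ∑ l, ‖(∏ l' ∈ Finset.univ.erase l, x l' ^ a l') * ((a l : ℝ) * x l ^ (a l - 1) * v l)‖ :=
        norm_sum_le _ _
    _ ≤ ∑ l, (a l : ℝ) * ρ ^ a.degree * ‖v‖ := Finset.sum_le_sum fun l _ => hterm l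
    _ = (a.degree : ℝ) * ρ ^ a.degree * ‖v‖ := by
        rw [← Finset.sum_mul, ← Finset.sum_mul, Finsupp.degree_eq_sum, Nat.cast_sum]

/-- The derivative of a monomial depends continuously on the point. [folklore] -/
theorem continuous_monomialDeriv (a : Fin M →₀ ℕ) :
    Continuous fun x : Fin M → ℝ => ∑ l, (∏ l' ∈ Finset.univ.erase l, x l' ^ a l') •
        ((a l • x l ^ (a l - 1)) •
          ContinuousLinearMap.proj (R := ℝ) (φ := fun _ : Fin M => ℝ) l) := by
  refine continuous_finsetSum _ fun l _ => ?_
  refine (continuous_finsetProd _ fun l' _ => (continuous_apply l').pow _).smul ?_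
  exact (((continuous_apply l).pow _).const_smul (a l)).smul continuous_const

/-! ## The series -/

section Series

variable (γ : (Fin M →₀ ℕ) → ℝ) {ρ r : ℝ}

/-- The bounds `|γ a| |a| ρ^{|a|}` on the derivatives of the terms are summable for `ρ < r`.
[folklore] -/
theorem summable_derivBound (hρ : 1 ≤ ρ) (hρr : ρ < r)
    (hs : Summable fun a => |γ a| * r ^ a.degree) :
    Summable fun a : Fin M →₀ ℕ => |γ a| * ((a.degree : ℝ) * ρ ^ a.degree) := by
  have hρ0 : 0 ≤ ρ := zero_le_one.trans hρ
  refine (hs.mul_left (1 - ρ / r)⁻¹).of_nonneg_of_le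
    (fun a => mul_nonneg (abs_nonneg _) (mul_nonneg (Nat.cast_nonneg _) (pow_nonneg hρ0 _)))
    fun a => ?_
  calc |γ a| * ((a.degree : ℝ) * ρ ^ a.degree) ≤ |γ a| * ((1 - ρ / r)⁻¹ * r ^ a.degree) :=
        mul_le_mul_of_nonneg_left (nat_mul_pow_le_const_mul_pow hρ0 hρr _) (abs_nonneg _)
    _ = (1 - ρ / r)⁻¹ * (|γ a| * r ^ a.degree) := by ring

/-- The open box `(-ρ, ρ)ᴹ` is open. [folklore] -/
theorem isOpen_box (ρ : ℝ) : IsOpen (Set.pi Set.univ (fun _ : Fin M => Set.Ioo (-ρ) ρ)) :=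
  isOpen_set_pi finite_univ fun _ _ => isOpen_Ioo

/-- The open box `(-ρ, ρ)ᴹ` is preconnected (convex). [folklore] -/
theorem isPreconnected_box (ρ : ℝ) :
    IsPreconnected (Set.pi Set.univ (fun _ : Fin M => Set.Ioo (-ρ) ρ)) :=
  (convex_pi fun _ _ => convex_Ioo (-ρ) ρ).isPreconnected

/-- Coordinates of points of the open box are bounded by `ρ`. [folklore] -/
theorem abs_le_of_mem_box {ρ : ℝ} {x : Fin M → ℝ}
    (hx : x ∈ Set.pi Set.univ (fun _ : Fin M => Set.Ioo (-ρ) ρ)) (l : Fin M) : |x l| ≤ ρ :=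
  (abs_lt.mpr (hx l (mem_univ l))).le

/-- **Termwise differentiation of a real power series on the open box.** For
`Σₐ |γ a| r^{|a|} < ∞` and `1 ≤ ρ < r`, the sum `x ↦ Σₐ γ(a) xᵃ` has at every point of `(-ρ, ρ)ᴹ` the
Fréchet derivative `Σₐ γ(a) D(xᵃ)`. [folklore] -/
theorem hasFDerivAt_tsum_monomial (hρ : 1 ≤ ρ) (hρr : ρ < r)
    (hs : Summable fun a => |γ a| * r ^ a.degree) {x : Fin M → ℝ}
    (hx : x ∈ Set.pi Set.univ (fun _ : Fin M => Set.Ioo (-ρ) ρ)) :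
    HasFDerivAt (fun y : Fin M → ℝ => ∑' a : Fin M →₀ ℕ, γ a * ∏ l, y l ^ a l)
      (∑' a : Fin M →₀ ℕ, γ a • ∑ l, (∏ l' ∈ Finset.univ.erase l, x l' ^ a l') •
        ((a l • x l ^ (a l - 1)) •
          ContinuousLinearMap.proj (R := ℝ) (φ := fun _ : Fin M => ℝ) l)) x := by
  have hρ0 : 0 ≤ ρ := zero_le_one.trans hρ
  have h0 : (0 : Fin M → ℝ) ∈ Set.pi Set.univ (fun _ : Fin M => Set.Ioo (-ρ) ρ) :=
    fun l _ => ⟨by simp only [Pi.zero_apply]; linarith, by simp only [Pi.zero_apply]; linarith⟩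
  refine hasFDerivAt_tsum_of_isPreconnected (f := fun a (y : Fin M → ℝ) => γ a * ∏ l, y l ^ a l)
    (summable_derivBound γ hρ hρr hs) (isOpen_box ρ) (isPreconnected_box ρ)
    (fun a y _ => (hasFDerivAt_monomial a y).const_mul (γ a)) (fun a y hy => ?_) h0 ?_ hx
  · rw [norm_smul, Real.norm_eq_abs]
    exact mul_le_mul_of_nonneg_left (norm_monomialDeriv_le a hρ (abs_le_of_mem_box hy))
      (abs_nonneg _)
  · exact summable_monomialSeries γ hρ0 hρr.le hs (abs_le_of_mem_box h0)

/-- The family of derivatives `γ(a) D(xᵃ)` is summable in operator norm on the box. [folklore] -/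
theorem summable_smul_monomialDeriv (hρ : 1 ≤ ρ) (hρr : ρ < r)
    (hs : Summable fun a => |γ a| * r ^ a.degree) {x : Fin M → ℝ}
    (hx : x ∈ Set.pi Set.univ (fun _ : Fin M => Set.Ioo (-ρ) ρ)) :
    Summable fun a : Fin M →₀ ℕ => γ a • ∑ l, (∏ l' ∈ Finset.univ.erase l, x l' ^ a l') •
        ((a l • x l ^ (a l - 1)) •
          ContinuousLinearMap.proj (R := ℝ) (φ := fun _ : Fin M => ℝ) l) := by
  refine Summable.of_norm_bounded (summable_derivBound γ hρ hρr hs) fun a => ?_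
  rw [norm_smul, Real.norm_eq_abs]
  exact mul_le_mul_of_nonneg_left (norm_monomialDeriv_le a hρ (abs_le_of_mem_box hx))
    (abs_nonneg _)

/-- **Termwise partial derivatives**: on the open box,
`∂/∂xₗ Σₐ γ(a) xᵃ = Σₐ γ(a) aₗ xₗ^{aₗ-1} ∏_{l' ≠ l} x_{l'}^{a_{l'}}`. [folklore] -/
theorem fderiv_tsum_monomial_apply_single (hρ : 1 ≤ ρ) (hρr : ρ < r)
    (hs : Summable fun a => |γ a| * r ^ a.degree) {x : Fin M → ℝ}
    (hx : x ∈ Set.pi Set.univ (fun _ : Fin M => Set.Ioo (-ρ) ρ)) (l : Fin M) :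
    fderiv ℝ (fun y : Fin M → ℝ => ∑' a : Fin M →₀ ℕ, γ a * ∏ l, y l ^ a l) x (Pi.single l 1) =
      ∑' a : Fin M →₀ ℕ, γ a * ((∏ l' ∈ Finset.univ.erase l, x l' ^ a l') *
        ((a l : ℝ) * x l ^ (a l - 1))) := by
  rw [(hasFDerivAt_tsum_monomial γ hρ hρr hs hx).fderiv]
  have h := (ContinuousLinearMap.apply ℝ ℝ (Pi.single l 1 : Fin M → ℝ)).map_tsum
    (summable_smul_monomialDeriv γ hρ hρr hs hx)
  rw [ContinuousLinearMap.apply_apply] at h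
  rw [h]
  refine tsum_congr fun a => ?_
  rw [ContinuousLinearMap.apply_apply, _root_.smul_apply, monomialDeriv_apply_single, smul_eq_mul]

/-- **A real power series is `C¹` on the open box** `(-ρ, ρ)ᴹ`, `1 ≤ ρ < r`,
`Σₐ |γ a| r^{|a|} < ∞` (differentiable with continuous derivative, the series of derivatives
converging locally uniformly). [folklore] -/
theorem contDiffOn_tsum_monomial (hρ : 1 ≤ ρ) (hρr : ρ < r)
    (hs : Summable fun a => |γ a| * r ^ a.degree) :
    ContDiffOn ℝ 1 (fun y : Fin M → ℝ => ∑' a : Fin M →₀ ℕ, γ a * ∏ l, y l ^ a l)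
      (Set.pi Set.univ (fun _ : Fin M => Set.Ioo (-ρ) ρ)) := by
  rw [show (1 : WithTop ℕ∞) = 0 + 1 from rfl, contDiffOn_succ_iff_fderiv_of_isOpen (isOpen_box ρ)]
  refine ⟨fun x hx => (hasFDerivAt_tsum_monomial γ hρ hρr hs hx).differentiableAt.differentiableWithinAt,
    fun h => ?_, ?_⟩
  · exact absurd h (by simp)
  · rw [contDiffOn_zero]
    have hcont : ContinuousOn (fun x : Fin M → ℝ => ∑' a : Fin M →₀ ℕ, γ a •
        ∑ l, (∏ l' ∈ Finset.univ.erase l, x l' ^ a l') • ((a l • x l ^ (a l - 1)) •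
          ContinuousLinearMap.proj (R := ℝ) (φ := fun _ : Fin M => ℝ) l))
        (Set.pi Set.univ (fun _ : Fin M => Set.Ioo (-ρ) ρ)) := by
      refine continuousOn_tsum (fun a => ((continuous_monomialDeriv a).const_smul (γ a)).continuousOn)
        (summable_derivBound γ hρ hρr hs) fun a x hx => ?_
      rw [norm_smul, Real.norm_eq_abs]
      exact mul_le_mul_of_nonneg_left (norm_monomialDeriv_le a hρ (abs_le_of_mem_box hx))
        (abs_nonneg _)
    exact hcont.congr fun x hx => (hasFDerivAt_tsum_monomial γ hρ hρr hs hx).fderiv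

/-- The sum of the series is continuous on the open box. [folklore] -/
theorem continuousOn_tsum_monomial (hρ : 1 ≤ ρ) (hρr : ρ < r)
    (hs : Summable fun a => |γ a| * r ^ a.degree) :
    ContinuousOn (fun y : Fin M → ℝ => ∑' a : Fin M →₀ ℕ, γ a * ∏ l, y l ^ a l)
      (Set.pi Set.univ (fun _ : Fin M => Set.Ioo (-ρ) ρ)) :=
  (contDiffOn_tsum_monomial γ hρ hρr hs).continuousOn

end Series

/-! ## Registered form -/

/-- **Registered auxiliary stub** `stub_spanToRepsAuxC1` (sub-goal of `stub_spanToReps`, crux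
stmt-KontsevichZagierPeriods-3586): a real power series `Σₐ γ(a) xᵃ` with `Σₐ |γ a| r^{|a|} < ∞` is
`C¹` on the open box `(-ρ, ρ)ᴹ`, `1 ≤ ρ < r`, with termwise partial derivatives. [folklore] -/
theorem stub_spanToRepsAuxC1 :
    ∀ (M : ℕ) (γ : (Fin M →₀ ℕ) → ℝ) (ρ r : ℝ), 1 ≤ ρ → ρ < r →
      Summable (fun a : Fin M →₀ ℕ => |γ a| * r ^ a.degree) →
      ContDiffOn ℝ 1 (fun y : Fin M → ℝ => ∑' a : Fin M →₀ ℕ, γ a * ∏ l, y l ^ a l)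
        (Set.pi Set.univ (fun _ : Fin M => Set.Ioo (-ρ) ρ)) ∧
      ∀ x ∈ Set.pi Set.univ (fun _ : Fin M => Set.Ioo (-ρ) ρ), ∀ l : Fin M,
        fderiv ℝ (fun y : Fin M → ℝ => ∑' a : Fin M →₀ ℕ, γ a * ∏ l, y l ^ a l) x (Pi.single l 1) =
          ∑' a : Fin M →₀ ℕ, γ a * ((∏ l' ∈ Finset.univ.erase l, x l' ^ a l') *
            ((a l : ℝ) * x l ^ (a l - 1))) :=
  fun _ γ _ _ hρ hρr hs => ⟨contDiffOn_tsum_monomial γ hρ hρr hs,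
    fun _ hx l => fderiv_tsum_monomial_apply_single γ hρ hρr hs hx l⟩

end Summit.KontsevichZagierPeriods.KontsevichZagierPeriods.StokesGenerationLine
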